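import Literature.MathematicalPhysics.QuantumFieldTheory.Balaban1983to89.B6Prop26GradKLevelV1

/-!
# `Balaban1983to89.B6Prop26LeftFactorKLevelV1` — T. Bałaban, *Propagators and renormalization transformations for lattice gauge theories. II*,
# Commun. Math. Phys. **96** (1984) 223–250 [Balaban1984PropagatorsII], Prop. 2.6 p. 247: THE ENTRIES OF (2.136)–(2.140) WITH AN ARBITRARY
# LEFT FACTOR `D` (`∇`, `Δ`, a Hölder difference, a cut-off …) FOR THE GENUINE k-LEVEL `G = Δ_a⁻¹` ON THE V1 TORUS — THE UNIVERSAL LEFT-FACTOR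
# CLAUSE OF THE (2.141)-WALK WITH EVERY GLOBAL INPUT DISCHARGED (line 3 of (2.92) included): `DG` is bounded as soon as the first legs
# `D(h_□G_□h_□)` are

statement-level skeleton of published theorems with citation tags; proofs where landed; nothing here is a claim about the Yang–Mills mass gap

PDF held: `paper:balaban1984-cmp96-propagators-rt-ii` (journal page = PDF page + 222), p. 247 [PDF 25] re-read this generation on the ×2 render
`b2b-balaban-ref1/pages/1984-cmp96-propagators-rt-II/1984-cmp96-propagators-rt-II-p025-x2.png` and the text layer `p0025.txt`:
*"Reasoning in the same way as in the proof of Proposition 2.2 we obtain Proposition 2.6. There exists a positive constant δ₃ depending on d and L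
only, such that |(GJ)(x)|, |(∇GJ)(x)|, |(G∇*J)(x)|, |(ΔGJ)(x)| ≤ O(1)[(Lʲη)², Lʲη, Lʲη, 1]e^{−δ₃d(y,y′)}|J| (2.136) … ‖ζ∇GJ‖_α, ‖ζG∇*J‖_α ≤
O(1)(Lʲη)^{1−α}(‖ζ‖^ξ_α + |ζ|)e^{−δ₃d(y,y′)}|J|, ξ = L^{−j} (2.137) … The operator G can be represented as G = G₀(I − R)⁻¹ = Σ_{n≥0} G₀Rⁿ =
Σ_ω h_{□₀}G_{□₀}h_{□₀}K_{□₁,□₂}G_{□₂}h_{□₂}· … (2.141) and the series above is convergent in the norms appearing in the inequalities (2.136)–(2.140)."*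
— every LEFT entry (a factor `D` applied to `GJ` and read in a norm on the output block) is `DG = (DG₀)ΣRⁿ`: the SAME walk with the first leg
`DG₀ = Σ_□ D(h_□G_□h_□)`.

CITATION HEADER (lean-in-tree rule) — WHAT IS REPRODUCED.  Phase-2 file of the `lit-balaban` typed skeleton (HOME `run/shared/lean/pub/lit-balaban/`),
seat **p22 gen 26** (free target under protocol G.5-34(d), TAKING line HOME/STATUS.md 2026-08-23T22:15Z, cc the B6 fold owner r03 and p38); SKELETON
row **B6.Prop2.6** (cells only; head unchanged, owner r03).  THIS FILE = p38's PAIR ASSEMBLY `…B6Prop26PairKLevelAssemblyV1.prop26_pair_kLevel_assembly_le`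
(r03's (2.136)₁ assembly script with the conclusion strengthened to the universal left-factor clause) WITH ITS GLOBAL INPUTS DISCHARGED EXACTLY AS IN p38's
`…B6Prop26GradKLevelV1.prop26_2136_grad_kLevel_line3_le` / `…_unconditional` (the `□̃`-overlap `3·9^{d+1}` by `card_filter_mem_QbigT_le`, the output
localisation `outLoc_Ml_hB'`, the line-1 coefficient sizes/supports `abs_cfC_le`/`cfC_supp`/`abs_c0C_le`/`c0C_supp`, and — in §2 — line 3 of (2.92) by
r03's `…B6Line3CubeV1.line3_cube` with the Lemma-2.1 exponent `N₀ := ⌈2(d+1)log L/(ασ)⌉ + 1` chosen inside), BUT WITH THE LEFT FACTOR KEPT UNIVERSAL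
instead of specialised to `∇_ν` (p38) or `Δ` (p38's `…B6Prop26LapKLevelV1`):
* §1 **`prop26_leftFactor_kLevel_line3_le`** — binders of p38's `prop26_2136_grad_kLevel_line3_le` VERBATIM (line 3 displayed, rate `σ ≤ σ₀` a parameter);
  conclusion: the (2.136)₁ majorant `A·(L^{j(y)}/c′)²·e^{−δ₃d_T}` of `onFun G` AND, for EVERY `Dop : Module.End ℝ (bond functions)`, `A′ ≥ 0`, `Pw ≥ 0`:
  if every first leg `Dop·(h_□G_□h_□)` has the majorant `1_{□̃}(y)·A′·Pw(y)·e^{−σd_T(y,y′)}` then `Dop·onFun G` has the majorant `(A·A′)·Pw(y)·e^{−δ₃d_T(y,y′)}`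
  (`δ₃ = delta3 α (2σ)`, the SAME `A`);
* §2 **`prop26_leftFactor_kLevel_unconditional`** — NO DISPLAYED ANALYTIC HYPOTHESIS besides the first legs of the chosen `Dop`: binders of p38's
  `prop26_2136_grad_kLevel_unconditional` VERBATIM (`σ ≤ σ₁`, `0 < α ≤ 1`, one threshold `M₂ ≤ L·M_h`), same two conclusions;
* §3 **`prop26_leftFactor_kLevel_of_legs`** — the consumer's form: the legs may come with their own output indicator `1_{□⁺}` (`ST ⊆ SbigT`), constant
  `C_L ≥ 0` and rate `ρ_L > 0` fixed BEFORE `σ₁` (`σ₁ ≤ ρ_L`; p38's `_of_outLeg` convention): `HasMajorant (Dop·(h_□G_□h_□)) (1_{□⁺}(y)·C_L·Pw(y)·e^{−ρ_L d_T})`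
  for every cube ⟹ `HasMajorant (Dop·onFun G) ((A·C_L)·Pw(y)·e^{−δ₃ d_T})`.
USERS: the Hölder entries (2.137) (this seat's `…B6Prop26HolderGradKLevelV1`: `Dop` = a pair-difference operator times `∇_ν`), cut-off entries of (2.140),
r05's [B8] slot consumers — each supplies only its first legs.  IMPORTS BY NAME, restating nothing (`…B6Prop26GradKLevelV1` and through it
`…PairKLevelAssemblyV1`, `…Line3CubeV1`, `…CubeMoutV1`, `…CubeCoeffSizesV1`, `…Cover236QbigOverlapV1`); THEOREMS ONLY (no `def`, no `def … : Prop`);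
standard axioms.

HONEST SCOPE / DIVERGENCES.  (1) Nothing new is proved about `G`: this is the bookkeeping that turns p38's displayed-input pair assembly into a
hypothesis-free tool for arbitrary left factors; the analytic content is r03's/p38's/p22's cube lemmas and r03's line 3.  (2) As in the imported files:
V1 torus, `k ≥ 2`, `M_h = Lᵃ ≥ 8`, `R ≥ 2L²`, `P′ ≥ 5`, odd `L ≥ 5`, every top cube placed (print's setting (2.2), (2.16)); constants on `d, L, b₀, b₁, σ, α`
— print: *"O(1) depending on d and L"*; the padded no-placement twins (p38's `…_pad_V1` pattern) are not repeated here.  (3) Integer torus, lattice units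
(`η = |c′|⁻¹` enters only through the user's weight `Pw`); nothing on d = 4 specifically or the continuum; NOT summit progress.  Unit `lit-balaban-p22`
(gen 26), 2026-08-23.
-/

open scoped BigOperators
open Finset

namespace Literature.MathematicalPhysics.QuantumFieldTheory.Balaban1983to89.B6Prop26LeftFactorKLevelV1

open B4Reflection242 (boxDom)
open B6MultiLevelBoxOperator (N0)
open B6MultiLevelTorusOperator (TDomains)
open B6Cover236MultiLevelBlocks (cubes)
open B6Geom246MultiLevelTorus (geomT)
open B8Ineq192MultiLevelTorus (geomTB geomT_len)
open B6RandomWalk (HasMajorant hasMajorant_mono delta3)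
open B6Prop26Gluing (mulOp ind ind_nonneg OutLoc)
open B6Ineq2133TwoScaleV1 (onFun)
open B6GlobalChartV1 (PV domT blkV1)
open B6SectAOperatorsV1 (dE dsE RE BondIdx)
open B6SectAVectorModelV1 (GE)
open B6Ineq261LevelGap (K261 K261_nonneg)
open B6Prop26KLevelSkeletonV1 (hB zB ST pref pref_nonneg)
open B6Prop26KLevelSkeletonV2 (SbigT ST_subset_SbigT)
open B6CubeWindowV1 (Placed Gl Pl GlobalBand band_le one_le_of_eight_le four_le_of_five_le)
open B6CubeCoeffSizesV1 (abs_cfC_le cfC_supp abs_c0C_le c0C_supp s1C_nonneg s2C_nonneg)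
open B6CubeMoutV1 (outLoc_Ml_hB')
open B6Cover236QbigOverlapV1 (card_filter_mem_QbigT_le)
open B6Prop26KLevelAssemblyV1 (distT_nonneg)
open B6Prop26LeftEntryKLevelV1 (ind_mono)
open B6Prop26PairKLevelAssemblyV1 (prop26_pair_kLevel_assembly_le)
open B6Line3CubeV1 (line3_cube)

noncomputable section

/-- monotonicity of the exponential in the rate. [folklore] -/
private theorem exp_le_exp_of_rate {ρ σ t : ℝ} (h : σ ≤ ρ) (ht : 0 ≤ t) : Real.exp (-(ρ * t)) ≤ Real.exp (-(σ * t)) :=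
  Real.exp_le_exp.mpr (neg_le_neg (mul_le_mul_of_nonneg_right h ht))

/-- the budget inequality `e^{−ασ}·L^{2(d+1)/N₀} < 1` for `N₀ := ⌈2(d+1)·log L/(ασ)⌉₊ + 1` (`α, σ > 0`); p38's / r03's private `budget_lt_one`,
re-proved. [folklore] -/
private theorem budget_lt_one {d ℓ : ℕ} {α σ : ℝ} (hα : 0 < α) (hσ : 0 < σ) :
    Real.exp (-(α * σ)) * ((ℓ : ℝ) + 1) ^ ((2 * (d + 1 : ℕ) : ℝ) / (⌈2 * ((d : ℝ) + 1) * Real.log ((ℓ : ℝ) + 1) / (α * σ)⌉₊ + 1 : ℕ)) < 1 := by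
  have hL : (0 : ℝ) < (ℓ : ℝ) + 1 := by positivity
  have hlog : 0 ≤ Real.log ((ℓ : ℝ) + 1) := Real.log_nonneg (by linarith [(Nat.cast_nonneg ℓ : (0 : ℝ) ≤ ℓ)])
  have hN : 2 * ((d : ℝ) + 1) * Real.log ((ℓ : ℝ) + 1) / (α * σ) <
      ((⌈2 * ((d : ℝ) + 1) * Real.log ((ℓ : ℝ) + 1) / (α * σ)⌉₊ + 1 : ℕ) : ℝ) := by
    push_cast
    exact lt_of_le_of_lt (Nat.le_ceil _) (lt_add_one _)
  have hNpos : (0 : ℝ) < ((⌈2 * ((d : ℝ) + 1) * Real.log ((ℓ : ℝ) + 1) / (α * σ)⌉₊ + 1 : ℕ) : ℝ) := by positivity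
  have hασ : 0 < α * σ := mul_pos hα hσ
  have key : (2 * (d + 1 : ℕ) : ℝ) / (⌈2 * ((d : ℝ) + 1) * Real.log ((ℓ : ℝ) + 1) / (α * σ)⌉₊ + 1 : ℕ) * Real.log ((ℓ : ℝ) + 1) < α * σ := by
    rw [div_mul_eq_mul_div, div_lt_iff₀ hNpos]
    rw [div_lt_iff₀ hασ] at hN
    push_cast at hN ⊢
    nlinarith
  rw [Real.rpow_def_of_pos hL, ← Real.exp_add, Real.exp_lt_one_iff]
  nlinarith

/-- `N₀ + 1 ≤ R·(L·M_h)` from `N₀ + 1 ≤ L·M_h` (as reals) and `R ≥ 1`; p38's private `hRM_of_le`, re-proved. [folklore] -/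
private theorem hRM_of_le {ℓ Mh R N : ℕ} (hR2 : 2 * (ℓ + 1) ^ 2 ≤ R) (h : ((N : ℕ) : ℝ) + 1 ≤ ((ℓ : ℝ) + 1) * Mh) :
    N + 1 ≤ R * ((ℓ + 1) * Mh) := by
  have hR1 : 1 ≤ R := le_trans (by have := pow_pos (show 0 < ℓ + 1 by omega) 2; omega : 1 ≤ 2 * (ℓ + 1) ^ 2) hR2
  have h2 : N + 1 ≤ (ℓ + 1) * Mh := by exact_mod_cast h
  calc N + 1 ≤ (ℓ + 1) * Mh := h2
    _ = 1 * ((ℓ + 1) * Mh) := (one_mul _).symm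
    _ ≤ R * ((ℓ + 1) * Mh) := Nat.mul_le_mul_right _ hR1

variable {d ℓ : ℕ} {hd : 1 ≤ d + 1} {hL : Odd (ℓ + 1) ∧ 1 < ℓ + 1} {m K : ℕ} {Mh k R : ℕ} {P' : Fin (d + 1) → ℕ}

/-! ## §1  The universal left-factor clause, only line 3 displayed, at any rate `σ ≤ σ₀` -/

section Line3

open Classical in
/-- **PROPOSITION 2.6 FOR THE GENUINE k-LEVEL `G = Δ_a⁻¹` ON THE V1 TORUS — (2.136)₁ AND THE UNIVERSAL LEFT-FACTOR CLAUSE, ONLY LINE 3 DISPLAYED.**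
Binders = those of p38's `…B6Prop26GradKLevelV1.prop26_2136_grad_kLevel_line3_le` (rate `σ ≤ σ₀` a parameter, budget `α ∈ [0,1]`, Lemma-2.1 exponent
`N₀`, line-3 constants `C_D ≥ 0`, `c_D > 0`; admissible V1 torus, `c′ ≠ 0`, weights in the global band, the line-3 majorant (iv) for every cube);
conclusion: the (2.136)₁ majorant `A·(L^{j(y)}/c′)²·e^{−δ₃d_T}` of `onFun G` ∧ for EVERY left factor `Dop`, constant `A′ ≥ 0` and output weight
`Pw ≥ 0`: per-cube first legs `HasMajorant (Dop·(h_□·G_□·h_□)) (1_{□̃}(y)·A′·Pw(y)·e^{−σd_T})` ⟹ `HasMajorant (Dop·onFun G) ((A·A′)·Pw(y)·e^{−δ₃d_T})`,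
`δ₃ = delta3 α (2σ)` — print's *"DG = Σ_ω D(h_{□₀}G_{□₀}h_{□₀})K… convergent in the norms of (2.136)–(2.140)"*.
[cite: Balaban1984PropagatorsII, Prop. 2.6 (2.136)–(2.137) p.247, (2.141) p.247, (2.133)–(2.135) p.247, (2.92) p.239, (2.36) p.229, Lemma 2.1 p.234] -/
theorem prop26_leftFactor_kLevel_line3_le (d ℓ : ℕ) (hd : 1 ≤ d + 1) (hL : Odd (ℓ + 1) ∧ 1 < ℓ + 1) {b₀ b₁ : ℝ} (hb₀ : 0 < b₀) (hb₁ : b₀ ≤ b₁) :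
    ∃ σ₀ : ℝ, 0 < σ₀ ∧ ∀ (σ : ℝ), 0 < σ → σ ≤ σ₀ → ∀ (α : ℝ), 0 ≤ α → α ≤ 1 → ∀ (N₀ : ℕ), 0 < N₀ → ∀ {CD cD : ℝ}, 0 ≤ CD → 0 < cD →
    ∃ A M₁ : ℝ, 0 ≤ A ∧ 0 < M₁ ∧
    ∀ (m K : ℕ) {Mh k R : ℕ} {P' : Fin (d + 1) → ℕ}
      (hN : ∀ μ, N0 ℓ Mh k P' μ = (PV d ℓ m K hd hL).sitesPerDir 0) (D : TDomains d ℓ Mh k P' R) (hk : k ≤ m + K) (_ : 2 ≤ k)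
      {a : ℕ} (hMha : Mh = (ℓ + 1) ^ a) (hM8 : 8 ≤ Mh) (_ : 2 * (ℓ + 1) ^ 2 ≤ R) (hP5 : ∀ μ, 5 ≤ P' μ) (_ : 4 ≤ ℓ)
      (hpl : ∀ c : ↥(cubes D.toDomains), Placed ℓ k P' c.1)
      (_ : M₁ ≤ ((ℓ : ℝ) + 1) * Mh) (_ : N₀ + 1 ≤ R * ((ℓ + 1) * Mh))
      (_ : Real.exp (-(α * σ)) * ((ℓ : ℝ) + 1) ^ ((2 * (d + 1 : ℕ) : ℝ) / N₀) < 1)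
      {cf : ℝ} (hcf : cf ≠ 0) {w : BondIdx (domT hN D hk) → ℝ} (hw : ∀ i, 0 < w i) (_ : GlobalBand b₀ b₁ cf w)
      -- line 3 (r03 g22 / p22), the only per-cube analytic input left
      (_ : ∀ c : ↥(cubes D.toDomains), HasMajorant (g := geomTB D) (blkV1 hN D)
        (mulOp (zB hN D (one_le_of_eight_le hM8) (four_le_of_five_le hP5) c) *
          (onFun (dE (P := PV d ℓ m K hd hL) cf ∘ₗ (LinearMap.id - RE (domT hN D hk) cf) ∘ₗ dsE cf) -
            Pl hN hk (one_le_of_eight_le hM8) (four_le_of_five_le hP5) hMha c (band_le (d := d) (ℓ := ℓ) hb₀ hb₁) (hpl c) w cf) *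
          mulOp (hB hN D c))
        (fun y y'' => CD * cf ^ 2 * Real.exp (-(cD * (geomTB D).M)) / (geomTB D).len y ^ 2 * Real.exp (-((2 * σ) * (geomTB D).dist y y'')))),
      HasMajorant (g := geomT D) (blkV1 hN D) (onFun (GE (domT hN D hk) hcf hw))
        (fun y y' => A * pref cf y * Real.exp (-(delta3 α (2 * σ) * (geomT D).dist y y'))) ∧
      ∀ (Dop : Module.End ℝ (PBond (PV d ℓ m K hd hL) 0 → ℝ)) (A' : ℝ) (Pw : (geomT D).Site → ℝ), 0 ≤ A' → (∀ y, 0 ≤ Pw y) →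
        (∀ c : ↥(cubes D.toDomains), HasMajorant (g := geomT D) (blkV1 hN D)
          (Dop * (mulOp (hB hN D c) *
            Gl hN hk (one_le_of_eight_le hM8) (four_le_of_five_le hP5) hMha c (band_le (d := d) (ℓ := ℓ) hb₀ hb₁) (hpl c) w cf *
            mulOp (hB hN D c)))
          (fun y y' => ind (SbigT D (one_le_of_eight_le hM8) (four_le_of_five_le hP5) c) y *
            (A' * Pw y * Real.exp (-(σ * (geomT D).dist y y'))))) →
        HasMajorant (g := geomT D) (blkV1 hN D) (Dop * onFun (GE (domT hN D hk) hcf hw))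
          (fun y y' => A * A' * Pw y * Real.exp (-(delta3 α (2 * σ) * (geomT D).dist y y'))) := by
  obtain ⟨σ₀, hσ₀, h⟩ := prop26_pair_kLevel_assembly_le d ℓ hd hL hb₀ hb₁
  refine ⟨σ₀, hσ₀, fun σ hσ0 hσle α hα0 hα1 N₀ hN₀ CD cD hCD hcD => ?_⟩
  obtain ⟨A, M₁, hA, hM₁, h2⟩ := h σ hσ0 hσle α hα0 hα1 N₀ hN₀ (3 * 9 ^ (d + 1)) (s1C_nonneg d ℓ) (s2C_nonneg d ℓ) hCD hcD
  refine ⟨max A (2 * (((3 * 9 ^ (d + 1) : ℕ) : ℝ)) * K261 N₀ (d + 1) ((ℓ : ℝ) + 1) 1 (α * σ)), M₁, le_max_of_le_left hA, hM₁, ?_⟩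
  intro m K Mh k R P' hN D hk hk2 a hMha hM8 hR2 hP5 hℓ hpl hLM hRM hθ cf hcf w hw hwb hD3
  obtain ⟨h1, hclause⟩ := h2 m K hN D hk hk2 hMha hM8 hR2 hP5 hℓ hpl hLM hRM hθ hcf hw hwb
    (card_filter_mem_QbigT_le D hL (le_trans (by norm_num) hM8) hR2 (one_le_of_eight_le hM8) (four_le_of_five_le hP5))
    (fun c => outLoc_Ml_hB' hN hk (one_le_of_eight_le hM8) (four_le_of_five_le hP5) hMha c (band_le (d := d) (ℓ := ℓ) hb₀ hb₁)
      hM8 hR2 hP5 (hpl c) w cf)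
    (fun c e x => abs_cfC_le hN hk (one_le_of_eight_le hM8) (four_le_of_five_le hP5) hMha c (band_le (d := d) (ℓ := ℓ) hb₀ hb₁)
      hM8 hR2 hP5 (hpl c) w cf e x)
    (fun c e x hx => cfC_supp hN hk (one_le_of_eight_le hM8) (four_le_of_five_le hP5) hMha c (band_le (d := d) (ℓ := ℓ) hb₀ hb₁)
      hM8 hR2 hP5 (hpl c) w cf e x hx)
    (fun c x => abs_c0C_le hN hk (one_le_of_eight_le hM8) (four_le_of_five_le hP5) hMha c (band_le (d := d) (ℓ := ℓ) hb₀ hb₁)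
      hM8 hR2 hP5 (hpl c) w cf x)
    (fun c x hx => c0C_supp hN hk (one_le_of_eight_le hM8) (four_le_of_five_le hP5) hMha c (band_le (d := d) (ℓ := ℓ) hb₀ hb₁)
      hM8 hR2 hP5 (hpl c) w cf x hx)
    hD3
  have hdnn : ∀ y y' : (geomT D).Site, 0 ≤ (geomT D).dist y y' := distT_nonneg
  refine ⟨hasMajorant_mono _ h1 fun y y' => ?_, fun Dop A' Pw hA' hPw hlegs => ?_⟩
  · have := pref_nonneg cf y
    exact mul_le_mul_of_nonneg_right (mul_le_mul_of_nonneg_right (le_max_left _ _) this) (Real.exp_nonneg _)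
  · refine hasMajorant_mono _ (hclause Dop A' Pw hA' hPw hlegs) fun y y' => ?_
    have hP := hPw y
    calc 2 * ((((3 * 9 ^ (d + 1) : ℕ)) : ℝ) * A') * K261 N₀ (d + 1) ((ℓ : ℝ) + 1) 1 (α * σ) * Pw y *
          Real.exp (-(delta3 α (2 * σ) * (geomT D).dist y y'))
        = (2 * (((3 * 9 ^ (d + 1) : ℕ) : ℝ)) * K261 N₀ (d + 1) ((ℓ : ℝ) + 1) 1 (α * σ)) * A' * Pw y *
          Real.exp (-(delta3 α (2 * σ) * (geomT D).dist y y')) := by ring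
      _ ≤ max A (2 * (((3 * 9 ^ (d + 1) : ℕ) : ℝ)) * K261 N₀ (d + 1) ((ℓ : ℝ) + 1) 1 (α * σ)) * A' * Pw y *
          Real.exp (-(delta3 α (2 * σ) * (geomT D).dist y y')) :=
        mul_le_mul_of_nonneg_right (mul_le_mul_of_nonneg_right (mul_le_mul_of_nonneg_right (le_max_right _ _) hA') hP)
          (Real.exp_nonneg _)

end Line3

/-! ## §2  Line 3 discharged (r03's `line3_cube`): no displayed analytic hypothesis besides the first legs of the chosen left factor -/

section Unconditional

open Classical in
/-- **PROPOSITION 2.6, EVERY LEFT ENTRY, AT k LEVELS FOR THE GENUINE `G = Δ_a⁻¹` OF THE V1 TORUS — NO DISPLAYED ANALYTIC HYPOTHESIS** (binders of p38's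
`prop26_2136_grad_kLevel_unconditional` VERBATIM: line 3 of (2.92) fed by r03 g22's `line3_cube`, the Lemma-2.1 exponent `N₀ := ⌈2(d+1)log L/(ασ)⌉ + 1`
chosen inside for `α > 0`, one threshold `M₂ ≤ L·M_h`, rate `σ ≤ σ₁ = min(σ₀, ρ₃/2)`): for every weight band `[b₀, b₁]` there is `σ₁ > 0` such that for
all `0 < σ ≤ σ₁`, `0 < α ≤ 1` there are `A ≥ 0`, `M₂ > 0` with: on every V1 global torus with `k ≥ 2`, `M_h = Lᵃ ≥ 8`, `M₂ ≤ L·M_h`, `R ≥ 2L²`, `P′ ≥ 5`,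
`L ≥ 5`, all cubes placed, `c′ ≠ 0`, weights in the band: the (2.136)₁ majorant `A·(L^{j(y)}/c′)²·e^{−δ₃d_T}` of `onFun G` AND, for every left factor
`Dop`, `A′ ≥ 0`, `Pw ≥ 0` whose first legs satisfy `HasMajorant (Dop·(h_□G_□h_□)) (1_{□̃}(y)·A′·Pw(y)·e^{−σd_T})` for every cube,
`HasMajorant (Dop·onFun G) ((A·A′)·Pw(y)·e^{−δ₃d_T})`, `δ₃ = delta3 α (2σ)`.
[cite: Balaban1984PropagatorsII, Prop. 2.6 (2.136)–(2.140) p.247, (2.141) p.247 («convergent in the norms appearing in (2.136)–(2.140)»), (2.92) p.239, Lemma 2.1 p.234] -/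
theorem prop26_leftFactor_kLevel_unconditional (d ℓ : ℕ) (hd : 1 ≤ d + 1) (hL : Odd (ℓ + 1) ∧ 1 < ℓ + 1) {b₀ b₁ : ℝ} (hb₀ : 0 < b₀)
    (hb₁ : b₀ ≤ b₁) :
    ∃ σ₁ : ℝ, 0 < σ₁ ∧ ∀ (σ : ℝ), 0 < σ → σ ≤ σ₁ → ∀ (α : ℝ), 0 < α → α ≤ 1 →
    ∃ A M₂ : ℝ, 0 ≤ A ∧ 0 < M₂ ∧
    ∀ (m K : ℕ) {Mh k R : ℕ} {P' : Fin (d + 1) → ℕ}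
      (hN : ∀ μ, N0 ℓ Mh k P' μ = (PV d ℓ m K hd hL).sitesPerDir 0) (D : TDomains d ℓ Mh k P' R) (hk : k ≤ m + K) (_ : 2 ≤ k)
      {a : ℕ} (hMha : Mh = (ℓ + 1) ^ a) (hM8 : 8 ≤ Mh) (_ : 2 * (ℓ + 1) ^ 2 ≤ R) (hP5 : ∀ μ, 5 ≤ P' μ) (_ : 4 ≤ ℓ)
      (hpl : ∀ c : ↥(cubes D.toDomains), Placed ℓ k P' c.1) (_ : M₂ ≤ ((ℓ : ℝ) + 1) * Mh)
      {cf : ℝ} (hcf : cf ≠ 0) {w : BondIdx (domT hN D hk) → ℝ} (hw : ∀ i, 0 < w i) (_ : GlobalBand b₀ b₁ cf w),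
      HasMajorant (g := geomT D) (blkV1 hN D) (onFun (GE (domT hN D hk) hcf hw))
        (fun y y' => A * pref cf y * Real.exp (-(delta3 α (2 * σ) * (geomT D).dist y y'))) ∧
      ∀ (Dop : Module.End ℝ (PBond (PV d ℓ m K hd hL) 0 → ℝ)) (A' : ℝ) (Pw : (geomT D).Site → ℝ), 0 ≤ A' → (∀ y, 0 ≤ Pw y) →
        (∀ c : ↥(cubes D.toDomains), HasMajorant (g := geomT D) (blkV1 hN D)
          (Dop * (mulOp (hB hN D c) *
            Gl hN hk (one_le_of_eight_le hM8) (four_le_of_five_le hP5) hMha c (band_le (d := d) (ℓ := ℓ) hb₀ hb₁) (hpl c) w cf *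
            mulOp (hB hN D c)))
          (fun y y' => ind (SbigT D (one_le_of_eight_le hM8) (four_le_of_five_le hP5) c) y *
            (A' * Pw y * Real.exp (-(σ * (geomT D).dist y y'))))) →
        HasMajorant (g := geomT D) (blkV1 hN D) (Dop * onFun (GE (domT hN D hk) hcf hw))
          (fun y y' => A * A' * Pw y * Real.exp (-(delta3 α (2 * σ) * (geomT D).dist y y'))) := by
  obtain ⟨ρ₃, CD, cD, M₃, hρ₃, hCD, hcD, hcube⟩ := line3_cube d ℓ hd hL hb₀ hb₁
  obtain ⟨σ₀, hσ₀, h⟩ := prop26_leftFactor_kLevel_line3_le d ℓ hd hL hb₀ hb₁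
  refine ⟨min σ₀ (ρ₃ / 2), lt_min hσ₀ (by linarith), fun σ hσ hσ1 α hα hα1 => ?_⟩
  obtain ⟨A, M₁, hA, hM₁, h2⟩ := h σ hσ (hσ1.trans (min_le_left _ _)) α hα.le hα1
    (⌈2 * ((d : ℝ) + 1) * Real.log ((ℓ : ℝ) + 1) / (α * σ)⌉₊ + 1) (Nat.succ_pos _) hCD hcD
  refine ⟨A, max (max M₁ M₃) (((⌈2 * ((d : ℝ) + 1) * Real.log ((ℓ : ℝ) + 1) / (α * σ)⌉₊ + 1 : ℕ) : ℝ) + 1), hA,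
    lt_max_of_lt_left (lt_max_of_lt_left hM₁), ?_⟩
  intro m K Mh k R P' hN D hk hk2 a hMha hM8 hR2 hP5 hℓ hpl hM cf hcf w hw hwb
  have hσρ : 2 * σ ≤ ρ₃ := by linarith [hσ1.trans (min_le_right _ _)]
  refine h2 m K hN D hk hk2 hMha hM8 hR2 hP5 hℓ hpl (((le_max_left _ _).trans (le_max_left _ _)).trans hM)
    (hRM_of_le hR2 ((le_max_right _ _).trans hM)) (budget_lt_one hα hσ) hcf hw hwb fun c => ?_
  refine hasMajorant_mono (g := geomTB D) (blkV1 hN D)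
    (hcube m K hN D hk hk2 hMha hM8 hR2 hP5 hℓ hpl (((le_max_right _ _).trans (le_max_left _ _)).trans hM) hcf w c) ?_
  intro y y''
  have hd0 : 0 ≤ (geomTB D).dist y y'' := Nat.cast_nonneg _
  refine mul_le_mul_of_nonneg_left (Real.exp_le_exp.2 (by nlinarith)) ?_
  have := B6Prop26KLevelAssemblyV1.lenTB_pos (D := D) y
  positivity

end Unconditional

/-! ## §3  The consumer's form: legs with their own output indicator `1_{□⁺}`, constant and rate -/

section OfLegs

open Classical in
/-- **EVERY LEFT ENTRY OF PROPOSITION 2.6 AT k LEVELS FROM ITS FIRST LEGS** (the shape in which the cube lemmas deliver them — p38's `hDG0_cube`,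
`hLapG0_cube`, this seat's Hölder legs: output indicator `1_{□⁺}(y)` (`ST`), a constant `C_L ≥ 0` and a rate `ρ_L > 0` fixed before `σ₁`): for every
weight band `[b₀, b₁]` and `ρ_L > 0` there is `σ₁ > 0` (`≤ ρ_L`) such that for all `0 < σ ≤ σ₁`, `0 < α ≤ 1` there are `A ≥ 0`, `M₂ > 0` with: on every
admissible V1 torus (binders of `prop26_leftFactor_kLevel_unconditional`), for every left factor `Dop`, `C_L ≥ 0`, `Pw ≥ 0`,
`(∀ □, HasMajorant (Dop·(h_□G_□h_□)) (1_{□⁺}(y)·C_L·Pw(y)·e^{−ρ_L d_T}))` ⟹ `HasMajorant (Dop·onFun G) ((A·C_L)·Pw(y)·e^{−δ₃ d_T})`, `δ₃ = delta3 α (2σ)`.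
[cite: Balaban1984PropagatorsII, Prop. 2.6 (2.136)–(2.140) p.247, (2.141) p.247, (2.133) p.247 (first legs)] -/
theorem prop26_leftFactor_kLevel_of_legs (d ℓ : ℕ) (hd : 1 ≤ d + 1) (hL : Odd (ℓ + 1) ∧ 1 < ℓ + 1) {b₀ b₁ : ℝ} (hb₀ : 0 < b₀)
    (hb₁ : b₀ ≤ b₁) {ρL : ℝ} (hρL : 0 < ρL) :
    ∃ σ₁ : ℝ, 0 < σ₁ ∧ σ₁ ≤ ρL ∧ ∀ (σ : ℝ), 0 < σ → σ ≤ σ₁ → ∀ (α : ℝ), 0 < α → α ≤ 1 →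
    ∃ A M₂ : ℝ, 0 ≤ A ∧ 0 < M₂ ∧
    ∀ (m K : ℕ) {Mh k R : ℕ} {P' : Fin (d + 1) → ℕ}
      (hN : ∀ μ, N0 ℓ Mh k P' μ = (PV d ℓ m K hd hL).sitesPerDir 0) (D : TDomains d ℓ Mh k P' R) (hk : k ≤ m + K) (_ : 2 ≤ k)
      {a : ℕ} (hMha : Mh = (ℓ + 1) ^ a) (hM8 : 8 ≤ Mh) (_ : 2 * (ℓ + 1) ^ 2 ≤ R) (hP5 : ∀ μ, 5 ≤ P' μ) (_ : 4 ≤ ℓ)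
      (hpl : ∀ c : ↥(cubes D.toDomains), Placed ℓ k P' c.1) (_ : M₂ ≤ ((ℓ : ℝ) + 1) * Mh)
      {cf : ℝ} (hcf : cf ≠ 0) {w : BondIdx (domT hN D hk) → ℝ} (hw : ∀ i, 0 < w i) (_ : GlobalBand b₀ b₁ cf w)
      (Dop : Module.End ℝ (PBond (PV d ℓ m K hd hL) 0 → ℝ)) (CL : ℝ) (Pw : (geomT D).Site → ℝ), 0 ≤ CL → (∀ y, 0 ≤ Pw y) →
      (∀ c : ↥(cubes D.toDomains), HasMajorant (g := geomT D) (blkV1 hN D)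
        (Dop * (mulOp (hB hN D c) *
          Gl hN hk (one_le_of_eight_le hM8) (four_le_of_five_le hP5) hMha c (band_le (d := d) (ℓ := ℓ) hb₀ hb₁) (hpl c) w cf *
          mulOp (hB hN D c)))
        (fun y y' => ind (ST D (one_le_of_eight_le hM8) (four_le_of_five_le hP5) c) y *
          (CL * Pw y * Real.exp (-(ρL * (geomT D).dist y y'))))) →
      HasMajorant (g := geomT D) (blkV1 hN D) (Dop * onFun (GE (domT hN D hk) hcf hw))
        (fun y y' => A * CL * Pw y * Real.exp (-(delta3 α (2 * σ) * (geomT D).dist y y'))) := by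
  obtain ⟨σ₁, hσ₁, h⟩ := prop26_leftFactor_kLevel_unconditional d ℓ hd hL hb₀ hb₁
  refine ⟨min σ₁ ρL, lt_min hσ₁ hρL, min_le_right _ _, fun σ hσ hσ1 α hα hα1 => ?_⟩
  obtain ⟨A, M₂, hA, hM₂, h2⟩ := h σ hσ (hσ1.trans (min_le_left _ _)) α hα hα1
  refine ⟨A, M₂, hA, hM₂, ?_⟩
  intro m K Mh k R P' hN D hk hk2 a hMha hM8 hR2 hP5 hℓ hpl hM cf hcf w hw hwb Dop CL Pw hCL hPw hlegs
  have hdnn : ∀ y y' : (geomT D).Site, 0 ≤ (geomT D).dist y y' := distT_nonneg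
  have hσρ : σ ≤ ρL := hσ1.trans (min_le_right _ _)
  refine (h2 m K hN D hk hk2 hMha hM8 hR2 hP5 hℓ hpl hM hcf hw hwb).2 Dop CL Pw hCL hPw fun c => ?_
  refine hasMajorant_mono _ (hlegs c) fun y y' => ?_
  have hP := hPw y
  exact mul_le_mul (ind_mono (ST_subset_SbigT D _ _ c) y)
    (mul_le_mul_of_nonneg_left (exp_le_exp_of_rate hσρ (hdnn y y')) (by positivity)) (by positivity) (ind_nonneg _ _)

end OfLegs

end

end Literature.MathematicalPhysics.QuantumFieldTheory.Balaban1983to89.B6Prop26LeftFactorKLevelV1
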